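import Literature.NumberTheory.GaloisRepresentations.GL2ModFourNonsplitCartanData
import HarnessLib

/-!
# Subgroups of `GL₂(ℤ/4ℤ)` with full reduction and two quadratic characters: full, or inside `ℍ`
# (proofs only)

Sorry-free `Proofs` companion (theorems only, no new definitions or facts; D-0014/D-0026) of
`GL2ModFourNonsplitCartanData`: the group-theoretic step of T. Dokchitser, V. Dokchitser, *Surjectivity of
mod `2ⁿ` representations of elliptic curves*, Math. Z. 272 (2012) 961–964, proof of Theorem (2):

> "`GL₂(ℤ/4ℤ)` does have a (unique up to conjugacy) proper subgroup which surjects onto `GL₂(ℤ/2ℤ)`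
> and onto `(ℤ/4ℤ)^×`, and has a `C₂ × C₂`-quotient. This group has index `4`, and is conjugate to
> `ℍ = ⟨(0 1; 3 0), (0 1; 1 1)⟩`."

in the following explicit form (`surjective_or_conj_subset_HH`).  Let `ρ : G →* M₂(ℤ/4ℤ)` be a
homomorphism from a group (so its values are invertible) such that
(L2) every element of `GL₂(𝔽₂)` is the reduction of some `ρ σ`;
(W1) `χ₋₁ ∘ det ∘ ρ` is nontrivial (`cm1`; for a curve: `√-1 ∉ ℚ`);
(W2) `(χ₋₁ ∘ det ∘ ρ) · (sgn ∘ ρ̄)` is nontrivial (for a curve: `ℚ(√Δ) ≠ ℚ(√-1)`, i.e.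
`Δ ∉ -ℚ^{×2}`).
Then EITHER `ρ` is onto `GL₂(ℤ/4ℤ)`, OR some conjugate `k (Im ρ) k⁻¹` lies in `ℍ` (the normaliser of
the non-split Cartan `ℤ/4[w₀]`, `24` elements, `GL2Mod4.HH`).  (All three hypotheses are needed: without
(W2) the index-`2` subgroup on which `sgn = χ₋₁ ∘ det` is a counterexample.)

Proof (explicit version of "a computation shows"; cf. Serre, *Abelian ℓ-adic representations*,
IV.3.4 Lemma 3).  Let `V̄ = {A : 1 + 2A ∈ Im ρ} ⊆ M₂(𝔽₂)`, an `𝔽₂`-subspace stable under conjugation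
by `GL₂(𝔽₂)` (§1).  Case I: `V̄` contains a rank-one idempotent — then it contains all six, hence the
matrix units, so `V̄ = M₂(𝔽₂)`, the kernel of reduction lies in the image and `ρ` is onto (§2).
Case II: `V̄ ∋ ω̄` or `ω̄²` and a nonzero non-identity trace-zero element — their sum is a rank-one
idempotent, Case I.  Case III: `V̄ ⊆ sl₂` — then `det = 1` on the kernel part of the image, so
`χ₋₁ ∘ det` factors through `GL₂(𝔽₂) ≅ S₃`, whose only characters of order `≤ 2` are `1` and `sgn`,
contradicting (W1) or (W2) (§3).  Remaining case: `V̄ ⊆ 𝔽₂[ω̄] = {0, 1, ω̄, ω̄²}` — then for a lift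
`m = ρ σ_ω` of `ω̄` every `ρ(τ) m ρ(τ)⁻¹` lies in `ℤ/4[m]`, i.e. `Im ρ` normalises the non-split Cartan
`ℤ/4[m]`, which a kernel element conjugates to `ℤ/4[w₀]`, whose normaliser is `ℍ` (§4, tables of
`GL2ModFourNonsplitCartanData` §4).

## References

* [DokchitserDokchitserMathZ2012] T. Dokchitser, V. Dokchitser, Math. Z. 272 (2012) 961–964,
  proof of the Theorem, clause (2). [corpus:paper:arxiv-1104.5031 p0001 L99–L104]
* [SerreAbelianLAdic1968] J.-P. Serre, *Abelian `ℓ`-adic representations and elliptic curves*,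
  Benjamin (1968), IV.3.4.
-/

set_option autoImplicit false

namespace Literature.NumberTheory.GaloisRepresentations.GL2Mod4

open Matrix
open Literature.NumberTheory.GaloisRepresentations.GL2Mod8 (P4 P4.mul P4.det)

variable {G : Type*} [Group G] (ρ : G →* M4)

/-! ### §0. The image consists of invertible matrices -/

/-- `det (ρ σ)` is a unit of `ℤ/4ℤ`: `det² = 1`, for the matrix and for its tuple of entries.
[cite: DokchitserDokchitserMathZ2012, proof of Theorem (2) (computation in GL₂(ℤ/4ℤ))] -/
theorem det_sq (σ : G) : (ρ σ).det * (ρ σ).det = 1 ∧ Q4.det (tup (ρ σ)) * Q4.det (tup (ρ σ)) = 1 := by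
  have h : (ρ σ).det * (ρ σ⁻¹).det = 1 := by
    rw [← Matrix.det_mul, ← map_mul, mul_inv_cancel, map_one, Matrix.det_one]
  exact ⟨mul_self_of_mul_eq_one h, by rw [← det_eq]; exact mul_self_of_mul_eq_one h⟩

/-- `ρ σ⁻¹ = inv' (ρ σ)`. [cite: DokchitserDokchitserMathZ2012, proof of Theorem (2) (computation in GL₂(ℤ/4ℤ))] -/
theorem map_inv_eq_inv' (σ : G) : ρ σ⁻¹ = inv' (ρ σ) :=
  (inv'_eq_of_mul_eq_one ((det_sq ρ σ).1) (by rw [← map_mul, mul_inv_cancel, map_one])).symm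

/-- The reduction of `ρ σ` lies in `GL₂(𝔽₂)`. [cite: DokchitserDokchitserMathZ2012, proof of Theorem (2) (computation in GL₂(ℤ/4ℤ))] -/
theorem par_det_one (σ : G) : P4.det (par (ρ σ)) = 1 :=
  (Q4.det_mul_self_iff _).mp (by rw [← det_eq]; exact (det_sq ρ σ).1)

/-- The reduction of `ρ σ · inv' (ρ τ)` is `1̄` when `ρ σ`, `ρ τ` have the same reduction. [cite: DokchitserDokchitserMathZ2012, proof of Theorem (2) (computation in GL₂(ℤ/4ℤ))] -/
theorem par_mul_inv'_of_par_eq {s t : M4} (ht : t.det * t.det = 1) (h : par s = par t) :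
    par (s * inv' t) = (1, 0, 0, 1) := by
  rw [par_mul, h, par_inv' t ht]
  exact (P4.det_mul_and_adj.2 _ ((Q4.det_mul_self_iff _).mp (by rw [← det_eq]; exact ht))).1

/-! ### §1. `V̄ = {A : 1 + 2A ∈ Im ρ}` is a subspace stable under `GL₂(𝔽₂)`-conjugation -/

/-- `0 ∈ V̄`. [cite: DokchitserDokchitserMathZ2012, proof of Theorem (2) (the kernel part of the image)] -/
theorem klift_zero_mem : ∃ σ : G, tup (ρ σ) = klift 0 :=
  ⟨1, by rw [map_one, tup_one, klift_facts.2]⟩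

/-- `V̄` is closed under addition. [cite: DokchitserDokchitserMathZ2012, proof of Theorem (2) (the kernel part of the image)] -/
theorem klift_add_mem {a b : P4} (ha : ∃ σ : G, tup (ρ σ) = klift a)
    (hb : ∃ σ : G, tup (ρ σ) = klift b) : ∃ σ : G, tup (ρ σ) = klift (a + b) := by
  obtain ⟨σ, hσ⟩ := ha
  obtain ⟨τ, hτ⟩ := hb
  exact ⟨σ * τ, by rw [map_mul, tup_mul, hσ, hτ, klift_mul]⟩

/-- `V̄` is closed under `if`-multiples (scalars of `𝔽₂`). [cite: DokchitserDokchitserMathZ2012, proof of Theorem (2) (the kernel part of the image)] -/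
theorem klift_ite_mem (c : Prop) [Decidable c] {v : P4} (hv : ∃ σ : G, tup (ρ σ) = klift v) :
    ∃ σ : G, tup (ρ σ) = klift (if c then v else 0) := by
  split_ifs
  · exact hv
  · exact klift_zero_mem ρ

/-- `V̄` is stable under conjugation by `GL₂(𝔽₂)` (conjugate `1 + 2A` by a lift of `p`), under (L2). [cite: DokchitserDokchitserMathZ2012, proof of Theorem (2) (the kernel part of the image)] -/
theorem klift_conj_mem (hL2 : ∀ p : P4, P4.det p = 1 → ∃ σ : G, par (ρ σ) = p) {a : P4}
    (ha : ∃ σ : G, tup (ρ σ) = klift a) {p : P4} (hp : P4.det p = 1) :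
    ∃ σ : G, tup (ρ σ) = klift (P4.conj p a) := by
  obtain ⟨σ, hσ⟩ := ha
  obtain ⟨π, hπ⟩ := hL2 p hp
  refine ⟨π * σ * π⁻¹, ?_⟩
  rw [map_mul, map_mul, tup_mul, tup_mul, hσ, map_inv_eq_inv', tup_inv',
    conj_klift _ ((det_sq ρ π).2), show Q4.par (tup (ρ π)) = p from hπ]

/-! ### §2. Case I: a rank-one idempotent in `V̄` forces `V̄ = M₂(𝔽₂)` and `ρ` onto -/

/-- If `V̄` contains a rank-one idempotent then `V̄ = M₂(𝔽₂)`. [cite: DokchitserDokchitserMathZ2012, proof of Theorem (2) (a computation in GL₂(ℤ/4ℤ))] -/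
theorem all_mem_of_idem (hL2 : ∀ p : P4, P4.det p = 1 → ∃ σ : G, par (ρ σ) = p) {a : P4}
    (ha : a ∈ idem6) (hma : ∃ σ : G, tup (ρ σ) = klift a) (x : P4) :
    ∃ σ : G, tup (ρ σ) = klift x := by
  have hI : ∀ b ∈ idem6, ∃ σ : G, tup (ρ σ) = klift b := by
    intro b hb
    obtain ⟨p, hp, hpb⟩ := idem6_conj a ha b hb
    rw [← hpb]
    exact klift_conj_mem ρ hL2 hma hp
  have h11 := hI (1, 0, 0, 0) (by decide)
  have h22 := hI (0, 0, 0, 1) (by decide)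
  have h12 : ∃ σ : G, tup (ρ σ) = klift (0, 1, 0, 0) := by
    rw [← P4_units.1]; exact klift_add_mem ρ (hI (1, 1, 0, 0) (by decide)) h11
  have h21 : ∃ σ : G, tup (ρ σ) = klift (0, 0, 1, 0) := by
    rw [← P4_units.2.1]; exact klift_add_mem ρ (hI (1, 0, 1, 0) (by decide)) h11
  suffices h : ∃ σ : G, tup (ρ σ) = klift ((if x.1 = 1 then (1, 0, 0, 0) else 0) +
      (if x.2.1 = 1 then (0, 1, 0, 0) else 0) + (if x.2.2.1 = 1 then (0, 0, 1, 0) else 0) +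
      (if x.2.2.2 = 1 then (0, 0, 0, 1) else 0)) by
    rwa [← P4_units.2.2 x] at h
  exact klift_add_mem ρ (klift_add_mem ρ (klift_add_mem ρ (klift_ite_mem ρ _ h11)
    (klift_ite_mem ρ _ h12)) (klift_ite_mem ρ _ h21)) (klift_ite_mem ρ _ h22)

/-- If `V̄ = M₂(𝔽₂)` (the whole kernel of reduction lies in the image) then, under (L2), `ρ` is onto
`GL₂(ℤ/4ℤ)`. [cite: DokchitserDokchitserMathZ2012, proof of Theorem (2) (a computation in GL₂(ℤ/4ℤ))] -/
theorem surj_of_all_mem (hL2 : ∀ p : P4, P4.det p = 1 → ∃ σ : G, par (ρ σ) = p)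
    (hall : ∀ x : P4, ∃ σ : G, tup (ρ σ) = klift x) (g : M4) (hg : g.det * g.det = 1) :
    ∃ σ : G, ρ σ = g := by
  obtain ⟨π, hπ⟩ := hL2 (par g) ((Q4.det_mul_self_iff _).mp (by rw [← det_eq]; exact hg))
  have hk : par (inv' (ρ π) * g) = (1, 0, 0, 1) := by
    rw [par_mul, par_inv' _ ((det_sq ρ π).1), ← hπ]
    exact (P4.det_mul_and_adj.2 _ (par_det_one ρ π)).2
  obtain ⟨τ, hτ⟩ := hall (Q4.half (tup (inv' (ρ π) * g)))
  rw [← eq_klift_half _ hk] at hτ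
  refine ⟨π * τ, ?_⟩
  rw [map_mul, tup_injective hτ, ← mul_assoc, mul_inv' ((det_sq ρ π).1), one_mul]

/-! ### §3. Case III: `V̄ ⊆ sl₂` contradicts (W1) or (W2) -/

/-- If every element of `V̄` has trace `0`, then `det ∘ ρ` depends only on the reduction `ρ̄`. [cite: DokchitserDokchitserMathZ2012, proof of Theorem (2) (surjects onto (ℤ/4ℤ)^×)] -/
theorem det_eq_of_par_eq (htr : ∀ a : P4, (∃ σ : G, tup (ρ σ) = klift a) → a.1 + a.2.2.2 = 0)
    {σ τ : G} (h : par (ρ σ) = par (ρ τ)) : (ρ σ).det = (ρ τ).det := by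
  have hm : par (ρ (σ * τ⁻¹)) = (1, 0, 0, 1) := by
    rw [map_mul, map_inv_eq_inv']
    exact par_mul_inv'_of_par_eq ((det_sq ρ τ).1) h
  have hkl := eq_klift_half _ hm
  have h0 := htr _ ⟨σ * τ⁻¹, hkl⟩
  obtain ⟨-, -, hsq, hcm⟩ := klift_facts.1 (Q4.half (tup (ρ (σ * τ⁻¹))))
  rw [h0] at hcm
  have hdet1 : (ρ (σ * τ⁻¹)).det = 1 := by
    rw [det_eq, hkl]; exact eq_one_of_cm1 hsq hcm
  have hst : ρ σ = ρ (σ * τ⁻¹) * ρ τ := by rw [← map_mul, inv_mul_cancel_right]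
  rw [hst, Matrix.det_mul, hdet1, one_mul]

/-- `x + x ≠ 1` in `ℤ/2`. [folklore] -/
private theorem add_self_ne_one : ∀ x : ZMod 2, x + x ≠ 1 := by decide

/-- **Case III.** Under (L2), (W1), (W2), some element of `V̄` has trace `1`. [cite: DokchitserDokchitserMathZ2012, proof of Theorem (2) (surjects onto (ℤ/4ℤ)^× and has a C₂ × C₂-quotient)] -/
theorem caseIII (hL2 : ∀ p : P4, P4.det p = 1 → ∃ σ : G, par (ρ σ) = p)
    (h₁ : ∃ σ : G, cm1 (ρ σ).det = 1) (h₂ : ∃ σ : G, cm1 (ρ σ).det + sg (ρ σ) = 1)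
    (htr : ∀ a : P4, (∃ σ : G, tup (ρ σ) = klift a) → a.1 + a.2.2.2 = 0) : False := by
  let s : Fin 6 → G := fun i ↦ Classical.choose (hL2 (gl2 i) (gl2_gl2idx.2 i))
  have hs : ∀ i, par (ρ (s i)) = gl2 i := fun i ↦
    Classical.choose_spec (hL2 (gl2 i) (gl2_gl2idx.2 i))
  let f : ZMod 2 × ZMod 2 × ZMod 2 × ZMod 2 × ZMod 2 × ZMod 2 :=
    (cm1 (ρ (s 0)).det, cm1 (ρ (s 1)).det, cm1 (ρ (s 2)).det, cm1 (ρ (s 3)).det,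
      cm1 (ρ (s 4)).det, cm1 (ρ (s 5)).det)
  have hF : ∀ i, F6 f i = cm1 (ρ (s i)).det := by
    intro i; fin_cases i <;> rfl
  have key : ∀ σ : G, cm1 (ρ σ).det = F6 f (gl2idx (par (ρ σ))) := by
    intro σ
    rw [hF]
    exact congrArg cm1 (det_eq_of_par_eq ρ htr (by rw [hs, gl2_gl2idx.1 _ (par_det_one ρ σ)]))
  have hom : ∀ i j : Fin 6, F6 f (gl2idx (P4.mul (gl2 i) (gl2 j))) = F6 f i + F6 f j := by
    intro i j
    have hij : par (ρ (s i * s j)) = P4.mul (gl2 i) (gl2 j) := by rw [map_mul, par_mul, hs, hs]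
    rw [← hij, ← key, map_mul, Matrix.det_mul,
      cm1_mul ((det_sq ρ _).1) ((det_sq ρ _).1), hF, hF]
  rcases hom_S3_cases f hom with h0 | hε
  · obtain ⟨σ, hσ⟩ := h₁
    rw [key, h0] at hσ
    exact zero_ne_one hσ
  · obtain ⟨σ, hσ⟩ := h₂
    rw [key, hε, gl2_gl2idx.1 _ (par_det_one ρ σ)] at hσ
    exact add_self_ne_one _ hσ

/-! ### §4. Case IV: `V̄ ⊆ 𝔽₂[ω̄]` puts the image in the normaliser of a non-split Cartan -/

/-- If `V̄ ⊆ {0, 1, ω̄, ω̄²}` and `ρ π = m` lifts `ω̄`, then every `ρ(τ) m ρ(τ)⁻¹` lies in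
`ℤ/4·1 + ℤ/4·m`. [cite: DokchitserDokchitserMathZ2012, proof of Theorem (2) (a computation in GL₂(ℤ/4ℤ))] -/
theorem conj_mem_lin_of_F4 (hF4 : ∀ a : P4, (∃ σ : G, tup (ρ σ) = klift a) → a ∈ F4set) {π : G}
    (hπ : par (ρ π) = (0, 1, 1, 1)) (τ : G) :
    ∃ ab : ZMod 4 × ZMod 4, tup (ρ τ * ρ π * inv' (ρ τ)) = Q4.lin ab.1 ab.2 (tup (ρ π)) := by
  have hπ' : Q4.par (tup (ρ π)) = (0, 1, 1, 1) := hπ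
  have hιπ : par (inv' (ρ π)) = (1, 1, 1, 0) := by
    have h := par_inv' (ρ π) ((det_sq ρ π).1)
    rw [hπ] at h
    exact h
  have hx : ρ (τ * π * τ⁻¹) = ρ τ * ρ π * inv' (ρ τ) := by rw [map_mul, map_mul, map_inv_eq_inv']
  have hpx : par (ρ (τ * π * τ⁻¹)) = P4.conj (par (ρ τ)) (0, 1, 1, 1) := by
    unfold P4.conj
    rw [hx, par_mul, par_mul, hπ, par_inv' _ ((det_sq ρ τ).1)]
  rcases omega2_facts.2 _ (par_det_one ρ τ) with h1 | h2
  · -- `x ≡ m (mod 2)`: `x m⁻¹ ∈ K ∩ Im ρ`, so `x = (1 + 2c) m` with `c ∈ 𝔽₂[ω̄]`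
    rw [← hpx] at h1
    have hk : par (ρ (τ * π * τ⁻¹ * π⁻¹)) = (1, 0, 0, 1) := by
      rw [map_mul, map_inv_eq_inv' ρ π]
      exact par_mul_inv'_of_par_eq ((det_sq ρ π).1) (h1.trans hπ.symm)
    have hkl := eq_klift_half _ hk
    obtain ⟨ab, hab⟩ := klift_F4_mem_lin _ (hF4 _ ⟨_, hkl⟩) _ hπ'
    have gm : ρ (τ * π * τ⁻¹ * π⁻¹) * ρ π = ρ τ * ρ π * inv' (ρ τ) := by
      rw [← map_mul, inv_mul_cancel_right, hx]
    rw [← gm, tup_mul, hkl, hab, Q4.lin_mul_gen]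
    exact ⟨(_, _), rfl⟩
  · -- `x ≡ m² (mod 2)`: `x m⁻² ∈ K ∩ Im ρ`
    rw [← hpx] at h2
    have hk : par (ρ (τ * π * τ⁻¹ * π⁻¹ * π⁻¹)) = (1, 0, 0, 1) := by
      have h : P4.mul (P4.mul ((1, 1, 1, 0) : P4) (1, 1, 1, 0)) (1, 1, 1, 0) = (1, 0, 0, 1) := by
        decide
      rw [map_mul, map_mul, map_inv_eq_inv' ρ π, par_mul, par_mul, h2, hιπ]
      exact h
    have hkl := eq_klift_half _ hk
    obtain ⟨ab, hab⟩ := klift_F4_mem_lin _ (hF4 _ ⟨_, hkl⟩) _ hπ'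
    have gm : ρ (τ * π * τ⁻¹ * π⁻¹ * π⁻¹) * ρ π * ρ π = ρ τ * ρ π * inv' (ρ τ) := by
      rw [← map_mul, ← map_mul, inv_mul_cancel_right, inv_mul_cancel_right, hx]
    rw [← gm, tup_mul, tup_mul, hkl, hab, Q4.lin_mul_gen, Q4.lin_mul_gen]
    exact ⟨(_, _), rfl⟩

/-- **Case IV.** If `V̄ ⊆ {0, 1, ω̄, ω̄²}` then, under (L2), a conjugate of `Im ρ` lies in `ℍ`. [cite: DokchitserDokchitserMathZ2012, proof of Theorem (2) (conjugate to ℍ)] -/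
theorem caseIV (hL2 : ∀ p : P4, P4.det p = 1 → ∃ σ : G, par (ρ σ) = p)
    (hF4 : ∀ a : P4, (∃ σ : G, tup (ρ σ) = klift a) → a ∈ F4set) :
    ∃ k : M4, k.det * k.det = 1 ∧ ∀ σ : G, tup (k * ρ σ * inv' k) ∈ HH := by
  obtain ⟨π, hπ⟩ := hL2 (0, 1, 1, 1) (by decide)
  have hπ' : Q4.par (tup (ρ π)) = (0, 1, 1, 1) := hπ
  obtain ⟨ab, hab⟩ := exists_kconj_lin_w0 _ hπ'
  generalize kc (Q4.half (tup (ρ π))) = c at hab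
  obtain ⟨-, hcpar, hcsq, -⟩ := klift_facts.1 c
  -- the conjugating matrix `K = 1 + 2c`, kept abstract through `hK`
  obtain ⟨K, hK⟩ : ∃ K : M4, tup K = klift c := ⟨ofTup (klift c), tup_ofTup _⟩
  have hKdet : K.det * K.det = 1 := by rw [det_eq, hK]; exact hcsq
  have hcancel : ∀ X : M4, inv' K * (K * X) = X := fun X ↦ by
    rw [← mul_assoc, inv'_mul hKdet, one_mul]
  -- `m' = K m K⁻¹ ∈ ℤ/4[w₀]` still lifts `ω̄`
  have hm'par : Q4.par (Q4.lin ab.1 ab.2 w0) = (0, 1, 1, 1) := by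
    have h : P4.mul (P4.mul ((1, 0, 0, 1) : P4) (0, 1, 1, 1))
        (((1, 0, 0, 1) : P4).2.2.2, ((1, 0, 0, 1) : P4).2.1, ((1, 0, 0, 1) : P4).2.2.1,
          ((1, 0, 0, 1) : P4).1) = (0, 1, 1, 1) := by
      decide
    rw [← hab, Q4.par_mul, Q4.par_mul, Q4.par_inv _ hcsq, hcpar, hπ']
    exact h
  refine ⟨K, hKdet, fun σ ↦ ?_⟩
  have hdetM : (K * ρ σ * inv' K).det * (K * ρ σ * inv' K).det = 1 := by
    have h := det_inv'_mul_self hKdet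
    have hσ := (det_sq ρ σ).1
    rw [Matrix.det_mul, Matrix.det_mul]
    linear_combination (K.det * K.det * ((ρ σ).det * (ρ σ).det)) * h +
      (K.det * K.det) * hσ + hKdet
  have hdet : Q4.det (tup (K * ρ σ * inv' K)) * Q4.det (tup (K * ρ σ * inv' K)) = 1 := by
    rw [← det_eq]; exact hdetM
  have hinv : inv' (K * ρ σ * inv' K) = K * inv' (ρ σ) * inv' K := by
    refine inv'_eq_of_mul_eq_one hdetM ?_
    simp only [mul_assoc, hcancel]
    rw [← mul_assoc (ρ σ), mul_inv' ((det_sq ρ σ).1), one_mul, mul_inv' hKdet]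
  -- `h m' h⁻¹ = K (ρσ m ρσ⁻¹) K⁻¹ ∈ K ℤ/4[m] K⁻¹ = ℤ/4[m']`
  obtain ⟨ab', hx⟩ := conj_mem_lin_of_F4 ρ hF4 hπ σ
  have eM : K * ρ σ * inv' K * (K * ρ π * inv' K) * inv' (K * ρ σ * inv' K) =
      K * (ρ σ * ρ π * inv' (ρ σ)) * inv' K := by
    rw [hinv]
    simp only [mul_assoc, hcancel]
  have e1 := congrArg tup eM
  simp only [tup_mul, tup_inv', hK] at e1 hx
  refine (mem_HH_iff _).mpr ⟨hdet, normalises_w0_of_normalises ab hm'par _ hdet ⟨ab', ?_⟩⟩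
  rw [← hab]
  simp only [tup_mul, tup_inv', hK]
  rw [e1, hx, Q4.conj_lin _ _ hcsq]

/-! ### §5. The dichotomy -/

/-- **Dokchitser–Dokchitser 2012, the group theory behind Theorem (2), explicit form.**  Let
`ρ : G →* M₂(ℤ/4ℤ)` be a homomorphism whose reduction realises every element of `GL₂(𝔽₂)` (L2), with
`χ₋₁ ∘ det` nontrivial on the image (W1) and `(χ₋₁ ∘ det) · sgn` nontrivial on the image (W2).  Then
either `ρ` is onto `GL₂(ℤ/4ℤ)` (every matrix of unit determinant is a value), or for some invertible
`k` the conjugate `k (Im ρ) k⁻¹` lies in `ℍ`, the normaliser of the non-split Cartan `ℤ/4[w₀]`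
(`24` elements, index `4`; Dokchitser–Dokchitser's `ℍ = ⟨(0 1; 3 0), (0 1; 1 1)⟩ ≅ C₃ ⋊ D₈`). [cite: DokchitserDokchitserMathZ2012, proof of Theorem (2) ("GL₂(ℤ/4ℤ) does have a (unique up to conjugacy) proper subgroup which surjects onto GL₂(ℤ/2ℤ) and onto (ℤ/4ℤ)^×, and has a C₂ × C₂-quotient. This group has index 4, and is conjugate to ℍ")] -/
theorem surjective_or_conj_subset_HH (hL2 : ∀ p : P4, P4.det p = 1 → ∃ σ : G, par (ρ σ) = p)
    (h₁ : ∃ σ : G, cm1 (ρ σ).det = 1) (h₂ : ∃ σ : G, cm1 (ρ σ).det + sg (ρ σ) = 1) :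
    (∀ g : M4, g.det * g.det = 1 → ∃ σ : G, ρ σ = g) ∨
      ∃ k : M4, k.det * k.det = 1 ∧ ∀ σ : G, tup (k * ρ σ * inv' k) ∈ HH := by
  by_cases hI : ∃ a ∈ idem6, ∃ σ : G, tup (ρ σ) = klift a
  · obtain ⟨a, ha, hma⟩ := hI
    exact Or.inl (surj_of_all_mem ρ hL2 (all_mem_of_idem ρ hL2 ha hma))
  by_cases hs : ∃ b ∈ sl2six, ∃ σ : G, tup (ρ σ) = klift b
  · exfalso
    by_cases hω : ∃ a ∈ omega2, ∃ σ : G, tup (ρ σ) = klift a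
    · obtain ⟨a, ha, hma⟩ := hω
      obtain ⟨b, hb, hmb⟩ := hs
      exact hI ⟨a + b, omega2_facts.1 a ha b hb, klift_add_mem ρ hma hmb⟩
    · refine caseIII ρ hL2 h₁ h₂ fun a hma ↦ ?_
      rcases P4_cover a with hF | hI' | hS
      · rcases P4_trace_zero.1 a hF with hω' | h0
        · exact absurd ⟨a, hω', hma⟩ hω
        · exact h0
      · exact absurd ⟨a, hI', hma⟩ hI
      · exact P4_trace_zero.2 a hS
  · right
    refine caseIV ρ hL2 fun a hma ↦ ?_
    rcases P4_cover a with hF | hI' | hS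
    · exact hF
    · exact absurd ⟨a, hI', hma⟩ hI
    · exact absurd ⟨a, hS, hma⟩ hs

end Literature.NumberTheory.GaloisRepresentations.GL2Mod4
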